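import Summits.BirchSwinnertonDyer.BirchSwinnertonDyer.Theorems.SmallImageMuTransferMuTransferX9SelmerDualLocalP
import Summits.BirchSwinnertonDyer.BirchSwinnertonDyer.Theorems.SmallImageMuTransferMuTransferX9SelmerDualTotallyRamified
import Summits.BirchSwinnertonDyer.BirchSwinnertonDyer.Theorems.SmallImageMuTransferMuTransferX9SelmerDualLocalEmbedKernel
import Summits.BirchSwinnertonDyer.BirchSwinnertonDyer.Theorems.SmallImageMuTransferMuTransferX9SelmerDualLocalUnramified
import Literature.NumberTheory.Automorphic.ReciprocityGLnCor93Proofs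
import HarnessLib

/-!
# K6 crux `MuTransferX9` (stmt-BirchSwinnertonDyer-19276), skeleton v6: the registered stub
# `stub_selmerDualOdd` PROVED — (L-p) assembled over `ℚ`, then lur-a's re-assembly

Cell `bsd-smallim`, seat `bsd-smallim-k6-c2` (gen 3, lead of crux 19276). HONEST FRAMING: theorems only; no
definition, no named fact, no `sorry`; nothing is booked (`--supports … --as helper`): the statement item of
the crux is closed by the skeleton's composition once the other registered stub (`stub_stepsTwoFourOdd`) lands.

* `localP` — **hypothesis (L-p) `hLp` of `SelmerDual.stub_selmerDualOdd_of_local(P)` VERBATIM**: the uniform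
  exponent `εp` at the place above `p`, from `localP_of` (p465054: Shapiro + one-double-coset Mackey + the
  uniform local exponent of a fine class at the totally ramified `p`) fed with lur-b's (Lp-2) total
  ramification `exists_mem_decomp_inv_mul_mem_kerSubgroup` (p463558) and (Lp-3) local embed kernel
  `localization_shiftH1_iterate_eq_zero_of_localization_map_shiftEmbed_eq_zero` (p464777) at a depth element
  of `κ⁻¹` over `p` (`exists_apply_absGaloisRestrict_ne_one` + k6-g4 `exists_trivial_depth_of_apply_ne_one`).
* `stub_selmerDualOdd_holds` — **the registered stub `stub_selmerDualOdd` of skeleton v6 (sha16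
  a90a661b046bb403) VERBATIM** `:= stub_selmerDualOdd_of_localP localP` (lur-a p462896: (L-bad) k6-g4/k6-c2
  p456573, (L-ur′) lur-a, (L-p) here).

MU-TRANSFER-PROOF §5 STEP 1, Selmer side, is thereby kernel-checked: for `y` fine with `(conj_γ − 1)^J y ≠ 0`
there is `Ψ ∈ H¹(ℚ, 𝒯_{J+1}(E, κ⁻¹))` of exact `T`-order `> J`, unramified off `S`, killed by `T^ε` on `S`.

PARTITION (D-0054): X9 (A4) × p ∈ {5,7} (+ X10b∧¬Surj at 3) — discharges the registered stub
`stub_selmerDualOdd`; closes no item by itself (the crux closes with `stub_stepsTwoFourOdd`).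

References: HOME/koly/MU-TRANSFER-PROOF.md §5 STEP 1; R. Greenberg, LNM 1716 (1999) §3 [GreenbergLNM1716];
B. Mazur, K. Rubin, Mem. AMS 799 (2004) §5.3 [MazurRubin2004]; L. Washington (1997) §13 [Washington1997].
-/

set_option linter.dupNamespace false
set_option autoImplicit false

noncomputable section

open scoped NumberField
open Field IsDedekindDomain Function
open WeierstrassCurve (geomTorsion geomPrimaryTorsion)
open Literature.NumberTheory.GaloisRepresentations
open Literature.NumberTheory.GaloisCohomology
open Literature.NumberTheory.EllipticCurves
open Literature.NumberTheory.EllipticCurves.GreenbergSelmer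

namespace Summit.BirchSwinnertonDyer.BirchSwinnertonDyer.Rank1Residual.SelmerDual

/-- **(L-p): the hypothesis `hLp` of `SelmerDual.stub_selmerDualOdd_of_local(P)`, VERBATIM** — the uniform
local exponent at the place above `p` for the Selmer-side classes `Ψ` built from FINE classes `y`.
[cite: GreenbergLNM1716, §3] [cite: MazurRubin2004, §5.3] -/
theorem localP :
    ∀ (W : WeierstrassCurve ℚ) [W.IsElliptic] [W.IsGloballyMinimal] (p : ℕ) [Fact p.Prime]
      (κ : ZpExtension ℚ p) (γ : absoluteGaloisGroup ℚ),
      p ≠ 2 → W.HasIrreducibleModPGaloisRep p → ¬ W.HasSurjectiveModNGaloisRep p →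
      κ.IsCyclotomic → κ.IsTopGenerator γ →
      (∀ v : HeightOneSpectrum (𝓞 ℚ), localEulerPoincareCharacteristic (v.adicCompletion ℚ)) →
      poitouTate_sum_localTatePairing_eq_zero ℚ →
      ∃ εp : ℕ, ∀ (v : HeightOneSpectrum (𝓞 ℚ)), ((p : ℕ) : 𝓞 ℚ) ∈ v.asIdeal →
        ∀ (J n : ℕ) (hJn : J + 1 ≤ p ^ n)
          (y : Literature.NumberTheory.EllipticCurves.subgroupH1 κ.kerSubgroup
            (WeierstrassCurve.geomTorsion W (p : ℤ))),
          W.torsionToPrimaryH1Sub p κ.kerSubgroup y ∈ W.fineSelmerInfty κ →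
          ∀ (yn : Literature.NumberTheory.EllipticCurves.subgroupH1 (κ.invTwist.layerSubgroup n)
              (WeierstrassCurve.geomTorsion W (p : ℤ)))
            (Y : galoisCohomology (W.modPTwist p κ.invTwist (p ^ n)) 1)
            (Ψ : galoisCohomology (W.modPTwist p κ.invTwist (J + 1)) 1) (k : ℕ),
            Literature.NumberTheory.EllipticCurves.resOfLe (WeierstrassCurve.geomTorsion W (p : ℤ))
                (κ.invTwist.kerSubgroup_le_layerSubgroup n) yn =
              Literature.NumberTheory.EllipticCurves.resOfLe (WeierstrassCurve.geomTorsion W (p : ℤ))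
                (κ.kerSubgroup_unitTwist (-1)).le y →
            κ.invTwist.twistModPH1Equiv (W.torsionGaloisModule (p : ℤ))
              (fun P : WeierstrassCurve.geomTorsion W (p : ℤ) => AddSubgroup.torsionBy.nsmul P) n Y = yn →
            galoisCohomology.map (κ.invTwist.twistModPShiftEmbed (W.torsionGaloisModule (p : ℤ))
              (fun P : WeierstrassCurve.geomTorsion W (p : ℤ) => AddSubgroup.torsionBy.nsmul P) (p ^ n) hJn)
                1 Ψ =
              (κ.invTwist.shiftH1 (W.torsionGaloisModule (p : ℤ))
                (fun P : WeierstrassCurve.geomTorsion W (p : ℤ) => AddSubgroup.torsionBy.nsmul P)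
                (p ^ n))^[k] Y →
            ∀ ε' : ℕ, εp ≤ ε' →
              galoisCohomology.localization (W.modPTwist p κ.invTwist (J + 1)) (Sum.inr v) 1
                ((κ.invTwist.shiftH1 (W.torsionGaloisModule (p : ℤ))
                  (fun P : WeierstrassCurve.geomTorsion W (p : ℤ) => AddSubgroup.torsionBy.nsmul P)
                  (J + 1))^[ε'] Ψ) = 0 := by
  intro W _ _ p _ κ γ hp2 _ _ hκ hγ _ _
  classical
  have hp : p.Prime := Fact.out
  by_cases hex : ∃ v₀ : HeightOneSpectrum (𝓞 ℚ), ((p : ℕ) : 𝓞 ℚ) ∈ v₀.asIdeal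
  swap
  · exact ⟨0, fun v hv => absurd ⟨v, hv⟩ hex⟩
  obtain ⟨v₀, hv₀⟩ := hex
  -- a depth element for `κ⁻¹` over `p`, acting trivially on `E[p]` (k6-g4), from total ramification (lur-b)
  haveI : Finite (geomTorsion W (p : ℤ)) :=
    WeierstrassCurve.finite_torsionPoints_holds W (AlgebraicClosure ℚ) (Int.natCast_ne_zero.mpr hp.ne_zero)
  obtain ⟨τ, hτ⟩ := exists_apply_absGaloisRestrict_ne_one κ hκ v₀ hv₀
  have hτ' : κ.invTwist (absGaloisRestrict ℚ (v₀.adicCompletion ℚ) τ) ≠ 1 := by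
    intro h1
    apply hτ
    apply Multiplicative.toAdd.injective
    have h2 := congrArg Multiplicative.toAdd h1
    rw [ZpExtension.toAdd_invTwist_apply, toAdd_one, neg_eq_zero] at h2
    rw [h2, toAdd_one]
  obtain ⟨g, m, hg, -, hgm, hgm'⟩ := LocalSplitPrime.exists_trivial_depth_of_apply_ne_one
    (W.torsionGaloisModule (p : ℤ)) κ.invTwist v₀ τ hτ'
  have hd : Nat.card (geomTorsion W (p : ℤ)) ≤ p ^ Nat.card (geomTorsion W (p : ℤ)) :=
    (Nat.lt_pow_self hp.one_lt).le
  have h3 : ∃ e : ℕ, ∀ {J L : ℕ} (hJL : J ≤ L) (c : galoisCohomology (W.modPTwist p κ.invTwist J) 1),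
      galoisCohomology.localization (W.modPTwist p κ.invTwist L) (Sum.inr v₀) 1
          (galoisCohomology.map (κ.invTwist.twistModPShiftEmbed (W.torsionGaloisModule (p : ℤ))
            (fun P : geomTorsion W (p : ℤ) => AddSubgroup.torsionBy.nsmul P) L hJL) 1 c) = 0 →
        galoisCohomology.localization (W.modPTwist p κ.invTwist J) (Sum.inr v₀) 1
          ((κ.invTwist.shiftH1 (W.torsionGaloisModule (p : ℤ))
            (fun P : geomTorsion W (p : ℤ) => AddSubgroup.torsionBy.nsmul P) J)^[e] c) = 0 :=
    ⟨Nat.card (geomTorsion W (p : ℤ)) * p ^ m, fun hJL c hc =>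
      localization_shiftH1_iterate_eq_zero_of_localization_map_shiftEmbed_eq_zero
        (W.torsionGaloisModule (p : ℤ)) (fun P : geomTorsion W (p : ℤ) => AddSubgroup.torsionBy.nsmul P)
        κ.invTwist v₀ hg hgm hgm' hd hJL c hc⟩
  obtain ⟨εp, hεp⟩ := localP_of W κ v₀ hp2 hγ hv₀
    (fun g => exists_mem_decomp_inv_mul_mem_kerSubgroup κ hκ v₀ hv₀ g) h3
  refine ⟨εp, fun v hv => ?_⟩
  obtain rfl := Literature.NumberTheory.Automorphic.heightOneSpectrum_rat_eq_of_natCast_mem hp hv hv₀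
  exact hεp

/-- **The registered stub `stub_selmerDualOdd` of skeleton v6 (sha16 a90a661b046bb403) of crux 19276,
VERBATIM, PROVED**: lur-a's (L-p)-only re-assembly `stub_selmerDualOdd_of_localP` fed with `localP`.
MU-TRANSFER-PROOF §5 STEP 1 (Selmer side). [cite: GreenbergLNM1716, §3] [cite: MazurRubin2004, §5.3] -/
theorem stub_selmerDualOdd_holds :
    ∀ (W : WeierstrassCurve ℚ) [W.IsElliptic] [W.IsGloballyMinimal] (p : ℕ) [Fact p.Prime]
      (κ : ZpExtension ℚ p) (γ : absoluteGaloisGroup ℚ),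
      p ≠ 2 → W.HasIrreducibleModPGaloisRep p → ¬ W.HasSurjectiveModNGaloisRep p →
      κ.IsCyclotomic → κ.IsTopGenerator γ →
      (∀ v : HeightOneSpectrum (𝓞 ℚ), localEulerPoincareCharacteristic (v.adicCompletion ℚ)) →
      poitouTate_sum_localTatePairing_eq_zero ℚ →
      ∀ (S₀ : Set (HeightOneSpectrum (𝓞 ℚ))), S₀.Finite →
      ∃ (ε : ℕ) (S : Set (HeightOneSpectrum (𝓞 ℚ))), S.Finite ∧ S₀ ⊆ S ∧
        ∀ (J : ℕ) (y : Literature.NumberTheory.EllipticCurves.subgroupH1 κ.kerSubgroup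
            (WeierstrassCurve.geomTorsion W (p : ℤ))),
          W.torsionToPrimaryH1Sub p κ.kerSubgroup y ∈ W.fineSelmerInfty κ →
          (⇑(Literature.NumberTheory.EllipticCurves.conjH1 κ.kerSubgroup
              (WeierstrassCurve.geomTorsion W (p : ℤ)) γ -
            AddMonoidHom.id (Literature.NumberTheory.EllipticCurves.subgroupH1 κ.kerSubgroup
              (WeierstrassCurve.geomTorsion W (p : ℤ)))))^[J] y ≠ 0 →
          ∃ Ψ : galoisCohomology (W.modPTwist p κ.invTwist (J + 1)) 1,
            (κ.invTwist.shiftH1 (W.torsionGaloisModule (p : ℤ))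
                (fun P : WeierstrassCurve.geomTorsion W (p : ℤ) => AddSubgroup.torsionBy.nsmul P)
                (J + 1))^[J] Ψ ≠ 0 ∧
            (∀ v : HeightOneSpectrum (𝓞 ℚ), v ∉ S →
              galoisCohomology.localization (W.modPTwist p κ.invTwist (J + 1)) (Sum.inr v) 1 Ψ ∈
                DiscreteGaloisModule.unramifiedSubgroup
                  (GaloisRep.toLocal v (W.modPTwist p κ.invTwist (J + 1))) 1) ∧
            (∀ v : HeightOneSpectrum (𝓞 ℚ), v ∈ S →
              galoisCohomology.localization (W.modPTwist p κ.invTwist (J + 1)) (Sum.inr v) 1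
                ((κ.invTwist.shiftH1 (W.torsionGaloisModule (p : ℤ))
                  (fun P : WeierstrassCurve.geomTorsion W (p : ℤ) => AddSubgroup.torsionBy.nsmul P)
                  (J + 1))^[ε] Ψ) = 0) :=
  stub_selmerDualOdd_of_localP localP

end Summit.BirchSwinnertonDyer.BirchSwinnertonDyer.Rank1Residual.SelmerDual

end
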